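import Summits.AtomisticToContinuum.Crystallization.Theorems.ChargedEnergyGapFeetLawA
import HarnessLib

/-!
# ChargedEnergyGap · NODE 91 «StencilTuple» — the certified translation of (D¹) to seven-point depth tuples in the standard frame

decomp-a2c lens-3 g90 (lens «one certified translation + split beneath»; route (R-i′) of critic row 1586, door 0b of row 1590 (A)).
Line of record: `stmt-AtomisticToContinuum-14231` `ChargedEnergyGap`; tree chain NODE 88 ThawSplit → NODE 89 DominoLedger{A,B,K} → NODE 90
FeetLaw{A,} (`SoloFeetLawQ`, `PairFeetLawQ`, `dominoLawQ'_of_feetLaws`, `chargedEnergyGap_of_feetLaw_numerics`).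

THE TRANSLATION (T¹) `StencilTupleLawQ` ⟺ (D¹) `SoloFeetLawQ` (`soloFeetLawQ_iff_stencilTupleLaw`, PROVED, both directions): the solo feet law
quantifies over a half-diagonal `ρ`, a cubic frame `(c₀, f)`, a point obstacle `S` of at most seven points and a feet-admissible lattice hole `w`;
but both of its sides read the lattice depth field `d_S = dist(cubicPt ·, S)` ONLY on the seven-point stencil `w, w ± eᵢ` (§90.3 of part A), the
frame is removed by the frame isometry onto the STANDARD FRAME (`stdFrame = EuclideanSpace.basisFun`, hole at the origin), and «`d` is the stencil
restriction of the depth field of SOME point obstacle» is exactly REALISABILITY (`IsStencilRealisable`): every stencil point `p` has a FOOT `s_p`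
at distance `d p` from it and at distance `≥ d q` from every stencil point `q` (⇒: a nearest obstacle point; ⇐: the feet themselves are a
seven-point obstacle).  The parity clause `Odd (∑ wᵢ)` of `IsFeetHole` carries no information about the tuple (the standard hole `e₀` is odd) and
is dropped (`IsTupleHole`).  Hence (T¹): «for every `ρ ∈ [ρlo, ρhi]` and every REALISABLE depth tuple on the standard seven-point stencil that is
tuple-admissible, `feetHoleCost ≤ domCapK ∘ chargeDepth`» — a statement about SEVEN REAL NUMBERS, seven feet in `ℝ³` and `ρ`, with no lattice, no
frame, no obstacle set and no `Metric.infDist`: the object the (D¹) [CELL-LP] interval instrument certifies cell by cell (lens-3 g90 memo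
CELLLP-SPEC-g90 §1: in coordinates, realisability is `∀ p ∃ unit u_p ∀ q ≠ p, ρ (P_q − P_p)·u_p ≤ (ρ²|P_q − P_p|² + d_p² − d_q²)/(2 d_p)`).

[EQUIV (the lens's single allowed certified translation; no estimate is moved, no constant changes) · (T¹) UNDECIDED(test: = (D¹): desk sup
`0.969 Ĉ` at sheet depth `118.6`, tilt `5.2°`; the g90 CELL-LP prototype certifies the ridge cell of transversal width `0.05` with margin
`1.22 c_T` of the available `1.43 c_T`, RESULTS-g90 R5) · INSTRUMENTABLE (it IS the instrument's input format) · why it might fail: exactly as (D¹)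
— a realisable seven-point tuple in the bulk window whose feet cost beats `1.03 ×` the tilted two-foot cost.]

## WHAT IS PROVED HERE (no `sorry`, no new axioms)
§91.1 the standard frame and the shifted depth field (`stdFrame`, `stdPt`, `shiftField`; shift lemmas for every hole descriptor and the feet cost);
§91.2 the frame isometry (`sf_frame_transport`: an affine isometry of `E3` taking the lattice of `(c₀, f, ρ)` based at `w` onto the standard lattice);
§91.3 realisability (`IsStencilRealisable`; `isStencilRealisable_latDepth`: lattice depth fields of nonempty finite obstacles are realisable;
`latDepth_feet_eq`: the feet obstacle of a realisable tuple has that tuple as its stencil depths); §91.4 (T¹) `StencilTupleLawQ` and the equivalence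
`soloFeetLawQ_iff_stencilTupleLaw` (⇐ `soloFeetLawQ_of_stencilTupleLaw` is the direction the census uses). -/

noncomputable section
open scoped Classical
open Literature.MathematicalPhysics.StatisticalMechanics Literature.Geometry.DiscreteGeometry
open Summit.AtomisticToContinuum.Crystallization.Theses.PricedLinkCensus
open Summit.AtomisticToContinuum.Crystallization.Theorems.ChargedEnergyGapNegative

namespace Summit.AtomisticToContinuum.Crystallization.Theorems.ChargedEnergyGapChartDial

/-! ## §91.1 The standard frame and the shifted depth field -/
section StandardFrame

/-- ★ The STANDARD FRAME of `E3`: the coordinate orthonormal basis. -/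
def stdFrame : Fin 3 → E3 := fun i => EuclideanSpace.basisFun (Fin 3) ℝ i

/-- [formal bookkeeping] -/
theorem stdFrame_orthonormal : Orthonormal ℝ stdFrame := (EuclideanSpace.basisFun (Fin 3) ℝ).orthonormal

/-- ★ The STANDARD LATTICE POINT of index `z`: `Σᵢ (zᵢ ρ) eᵢ` (the cubic frame `(0, stdFrame, ρ)`). -/
def stdPt (ρ : ℝ) (z : Fin 3 → ℤ) : E3 := cubicPt 0 stdFrame ρ z

/-- ★ The SHIFTED DEPTH FIELD: `d` re-indexed at the hole `w` (`z ↦ d (w + z)`), so that the hole sits at the origin. -/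
def shiftField (d : (Fin 3 → ℤ) → ℝ) (w : Fin 3 → ℤ) : (Fin 3 → ℤ) → ℝ := fun z => d (w + z)

variable (ρ : ℝ) (d : (Fin 3 → ℤ) → ℝ) (w : Fin 3 → ℤ)

/-- [formal bookkeeping] -/
theorem sf_holeVertex (u : Fin 3 × Bool) : w + holeVertex 0 u = holeVertex w u := by
  unfold holeVertex
  rw [zero_add]

/-- [formal bookkeeping] -/
theorem sf_apply_zero : shiftField d w 0 = d w := by
  unfold shiftField
  rw [add_zero]

/-- [formal bookkeeping] -/
theorem sf_apply_holeVertex (u : Fin 3 × Bool) : shiftField d w (holeVertex 0 u) = d (holeVertex w u) := by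
  unfold shiftField
  rw [sf_holeVertex]

/-- [formal bookkeeping] -/
theorem sf_hDepthMin : hDepthMin (shiftField d w) 0 = hDepthMin d w := by
  unfold hDepthMin
  congr 1
  funext u
  exact sf_apply_holeVertex d w u

/-- [formal bookkeeping] -/
theorem sf_hKink (a : Fin 3) : hKink ρ (shiftField d w) 0 a = hKink ρ d w a := by
  unfold hKink
  rw [← fc_holeVertex_true, ← fc_holeVertex_false, ← fc_holeVertex_true, ← fc_holeVertex_false, sf_apply_zero,
    sf_apply_holeVertex, sf_apply_holeVertex]

/-- [formal bookkeeping] -/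
theorem sf_hMaxKink : hMaxKink ρ (shiftField d w) 0 = hMaxKink ρ d w := by
  unfold hMaxKink
  congr 1
  funext a
  exact sf_hKink ρ d w a

/-- [formal bookkeeping] -/
theorem sf_hAxis : hAxis ρ (shiftField d w) 0 = hAxis ρ d w := by
  unfold hAxis
  rw [sf_hKink, sf_hKink, sf_hMaxKink]

/-- [formal bookkeeping] -/
theorem sf_chargeDepth : chargeDepth ρ (shiftField d w) 0 = chargeDepth ρ d w := by
  unfold chargeDepth
  rw [sf_hAxis, ← fc_holeVertex_true, ← fc_holeVertex_false, ← fc_holeVertex_true, ← fc_holeVertex_false,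
    sf_apply_holeVertex, sf_apply_holeVertex]

/-- ★ The feet hole cost is read off the shifted field at the origin. [formal bookkeeping] -/
theorem sf_feetHoleCost (ϱ τ : ℝ) : feetHoleCost ϱ τ ρ (shiftField d w) 0 = feetHoleCost ϱ τ ρ d w := by
  unfold feetHoleCost
  refine Finset.sum_congr rfl fun u _ => ?_
  have h : (fun p => depthProfile ϱ (shiftField d w (holeVertex 0 (anchorLab u p)))) =
      fun p => depthProfile ϱ (d (holeVertex w (anchorLab u p))) := by
    funext p
    rw [sf_apply_holeVertex]
  rw [h]

/-- [formal bookkeeping] -/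
theorem stdPt_eq_sum (z : Fin 3 → ℤ) : stdPt ρ z = ∑ i, ((z i : ℝ) * ρ) • stdFrame i := by
  unfold stdPt cubicPt
  rw [zero_add]

/-- [formal bookkeeping] -/
theorem cubicPt_add_sub (c₀ : E3) (f : Fin 3 → E3) (z : Fin 3 → ℤ) :
    cubicPt c₀ f ρ (w + z) - cubicPt c₀ f ρ w = ∑ i, ((z i : ℝ) * ρ) • f i := by
  unfold cubicPt
  have h : ∀ i : Fin 3, (((w + z) i : ℤ) : ℝ) * ρ = (w i : ℝ) * ρ + (z i : ℝ) * ρ := by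
    intro i
    simp only [Pi.add_apply, Int.cast_add, add_mul]
  simp_rw [h, add_smul, Finset.sum_add_distrib]
  abel

end StandardFrame

/-! ## §91.2 The frame isometry onto the standard frame -/
section FrameTransport

/-- ★ **FRAME TRANSPORT (PROVED)**: for an orthonormal frame `f` of `E3` there is a map `Φ : E3 → E3` (the affine isometry «coordinates in the frame
based at the lattice point `w`») with `dist (stdPt ρ z) (Φ y) = dist (cubicPt c₀ f ρ (w + z)) y` for every lattice offset `z` and every point `y`. -/
theorem sf_frame_transport {f : Fin 3 → E3} (hf : Orthonormal ℝ f) (c₀ : E3) (ρ : ℝ) (w : Fin 3 → ℤ) :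
    ∃ Φ : E3 → E3, ∀ (z : Fin 3 → ℤ) (y : E3), dist (stdPt ρ z) (Φ y) = dist (cubicPt c₀ f ρ (w + z)) y := by
  let b : OrthonormalBasis (Fin 3) ℝ E3 := OrthonormalBasis.mk hf
    (by rw [hf.linearIndependent.span_eq_top_of_card_eq_finrank (by simp)])
  have hb : ∀ i, b i = f i := fun i => by rw [OrthonormalBasis.coe_mk]
  refine ⟨fun y => b.repr (y - cubicPt c₀ f ρ w), fun z y => ?_⟩
  have key : b.repr (cubicPt c₀ f ρ (w + z) - cubicPt c₀ f ρ w) = stdPt ρ z := by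
    rw [cubicPt_add_sub, map_sum, stdPt_eq_sum]
    refine Finset.sum_congr rfl fun i _ => ?_
    rw [LinearIsometryEquiv.map_smul, ← hb i, b.repr_self i]
    unfold stdFrame
    rw [EuclideanSpace.basisFun_apply]
  rw [← key, LinearIsometryEquiv.dist_map, dist_sub_right]

end FrameTransport

/-! ## §91.3 Realisable stencil tuples -/
section Realisable

/-- ★★ A **REALISABLE** depth tuple on the standard seven-point stencil (frame scale `ρ`; `dt` is read only on `stencil 0 = {0, ±eᵢ}`): every
stencil point `p` has a FOOT `s` with `dist (stdPt ρ p) s = dt p` and `dt q ≤ dist (stdPt ρ q) s` for every stencil point `q` — i.e. `dt` is the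
stencil restriction of the depth field of SOME point obstacle (`isStencilRealisable_latDepth` / `latDepth_feet_eq`).  In coordinates (foot
`s = stdPt ρ p + (dt p) u`, `|u| = 1`): `∀ q ≠ p, ρ (P_q − P_p)·u ≤ (ρ²|P_q − P_p|² + (dt p)² − (dt q)²)/(2 dt p)` — the CELL-LP realisability rows. -/
def IsStencilRealisable (ρ : ℝ) (dt : (Fin 3 → ℤ) → ℝ) : Prop :=
  ∀ p ∈ stencil 0, ∃ s : E3, dist (stdPt ρ p) s = dt p ∧ ∀ q ∈ stencil 0, dt q ≤ dist (stdPt ρ q) s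

/-- ★ **LATTICE DEPTH FIELDS ARE REALISABLE (PROVED)**: for a nonempty finite obstacle `S` and any cubic frame, the depth field of `S` shifted to any
hole `w` is a realisable stencil tuple (foot of `p` = a nearest point of `S` to `cubicPt (w + p)`, transported to the standard frame). -/
theorem isStencilRealisable_latDepth {f : Fin 3 → E3} (hf : Orthonormal ℝ f) (c₀ : E3) (ρ : ℝ) {S : Finset E3} (hS : S.Nonempty)
    (w : Fin 3 → ℤ) : IsStencilRealisable ρ (shiftField (latDepth (↑S) c₀ f ρ) w) := by
  obtain ⟨Φ, hΦ⟩ := sf_frame_transport hf c₀ ρ w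
  intro p _
  obtain ⟨s, hs, hd⟩ := S.finite_toSet.isCompact.exists_infDist_eq_dist (Finset.coe_nonempty.2 hS) (cubicPt c₀ f ρ (w + p))
  refine ⟨Φ s, ?_, fun q _ => ?_⟩
  · rw [hΦ]
    exact hd.symm
  · rw [hΦ]
    exact Metric.infDist_le_dist_of_mem hs

/-- ★ **THE FEET OBSTACLE (PROVED)**: feet `s p` of a realisable tuple `dt` form a nonempty obstacle of at most seven points whose lattice depth
field in the standard frame based at `−ρ e₀` agrees with `dt` on the stencil of the ODD hole `e₀`. -/
theorem latDepth_feet_eq {ρ : ℝ} {dt : (Fin 3 → ℤ) → ℝ} {s : (Fin 3 → ℤ) → E3}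
    (hs : ∀ p ∈ stencil 0, dist (stdPt ρ p) (s p) = dt p ∧ ∀ q ∈ stencil 0, dt q ≤ dist (stdPt ρ q) (s p))
    {z : Fin 3 → ℤ} (hz : z ∈ stencil 0) :
    latDepth (↑((stencil 0).image s)) (-(ρ • stdFrame 0)) stdFrame ρ (axisZ 0 + z) = dt z := by
  have hpt : cubicPt (-(ρ • stdFrame 0)) stdFrame ρ (axisZ 0 + z) = stdPt ρ z := by
    rw [add_comm, lm_cubicPt_add_axisZ]
    unfold stdPt cubicPt
    rw [zero_add]
    abel
  unfold latDepth
  rw [hpt]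
  have hne : (↑((stencil 0).image s) : Set E3).Nonempty := Finset.coe_nonempty.2 (Finset.Nonempty.image ⟨0, mem_stencil_self 0⟩ s)
  apply le_antisymm
  · calc Metric.infDist (stdPt ρ z) ↑((stencil 0).image s) ≤ dist (stdPt ρ z) (s z) :=
          Metric.infDist_le_dist_of_mem (Finset.mem_coe.2 (Finset.mem_image_of_mem s hz))
      _ = dt z := (hs z hz).1
  · obtain ⟨y, hy, hyd⟩ := ((stencil 0).image s).finite_toSet.isCompact.exists_infDist_eq_dist hne (stdPt ρ z)
    rw [Finset.mem_coe, Finset.mem_image] at hy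
    obtain ⟨p, hp, rfl⟩ := hy
    rw [hyd]
    exact (hs p hp).2 z hz

end Realisable

/-! ## §91.4 (T¹) the stencil tuple law and the equivalence with (D¹) -/
section TupleLaw

/-- ★ A **TUPLE-ADMISSIBLE** stencil tuple: `IsFeetHole` at the origin WITHOUT the parity clause (min vertex depth row `≥ 1`, i.e. `≥ 93.5`; kink
column `≥ 2`, i.e. max-kink `≥ 1`; min vertex depth `< 140` and `< dK`). -/
def IsTupleHole (dK ρ : ℝ) (dt : (Fin 3 → ℤ) → ℝ) : Prop :=
  1 ≤ capKRow (hDepthMin dt 0) ∧ 2 ≤ capKCol (hMaxKink ρ dt 0) ∧ hDepthMin dt 0 < 140 ∧ hDepthMin dt 0 < dK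

/-- [formal bookkeeping] -/
theorem isTupleHole_congr (dK : ℝ) {ρ : ℝ} {d₁ d₂ : (Fin 3 → ℤ) → ℝ} (h0 : d₁ 0 = d₂ 0) (hv : ∀ u, d₁ (holeVertex 0 u) = d₂ (holeVertex 0 u)) :
    IsTupleHole dK ρ d₁ ↔ IsTupleHole dK ρ d₂ := by
  unfold IsTupleHole
  rw [hDepthMin_congr hv, hMaxKink_congr h0 hv]

/-- ★★★ **(T¹) THE STENCIL TUPLE LAW** — for every half-diagonal `ρ ∈ [ρlo, ρhi]` and every REALISABLE, TUPLE-ADMISSIBLE depth tuple `dt` on the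
standard seven-point stencil: `feetHoleCost(dt) ≤ Ĉ_κ(sheet depth of dt)` (`domCapK ∘ chargeDepth`, the cap of NODE 89-K verbatim).  Seven real
depths, seven feet, one scale: the input format of the (D¹) [CELL-LP] census.  EQUIVALENT to (D¹) `SoloFeetLawQ` (`soloFeetLawQ_iff_stencilTupleLaw`). -/
def StencilTupleLawQ (dK unit ϱ τ ρlo ρhi : ℝ) : Prop :=
  ∀ ρ : ℝ, ρlo ≤ ρ → ρ ≤ ρhi → ∀ dt : (Fin 3 → ℤ) → ℝ, IsStencilRealisable ρ dt → IsTupleHole dK ρ dt →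
    feetHoleCost ϱ τ ρ dt 0 ≤ domCapK unit ϱ τ ρ (chargeDepth ρ dt 0)

/-- ★★ **(T¹) ⟹ (D¹) (PROVED)** — the direction the census uses: shift the lattice depth field of `S` to the hole, transport to the standard frame. -/
theorem soloFeetLawQ_of_stencilTupleLaw {dK unit ϱ τ ρlo ρhi : ℝ} (h : StencilTupleLawQ dK unit ϱ τ ρlo ρhi) :
    SoloFeetLawQ dK unit ϱ τ ρlo ρhi := by
  intro ρ h₁ h₂ c₀ f hf S hS _ w hw
  have hreal := isStencilRealisable_latDepth hf c₀ ρ hS w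
  have hhole : IsTupleHole dK ρ (shiftField (latDepth (↑S) c₀ f ρ) w) := by
    obtain ⟨-, hr, hc, h140, hK⟩ := hw
    refine ⟨?_, ?_, ?_, ?_⟩
    · rwa [sf_hDepthMin]
    · rwa [sf_hMaxKink]
    · rwa [sf_hDepthMin]
    · rwa [sf_hDepthMin]
  have hmain := h ρ h₁ h₂ _ hreal hhole
  rwa [sf_feetHoleCost, sf_chargeDepth] at hmain

/-- [formal bookkeeping] -/
theorem odd_sum_axisZ_zero : Odd (∑ i, axisZ (0 : Fin 3) i) := by
  decide

/-- ★★ **(D¹) ⟹ (T¹) (PROVED)**: the feet of a realisable tuple are a point obstacle of at most seven points realising it at the odd hole `e₀` of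
the standard frame based at `−ρ e₀`. -/
theorem stencilTupleLaw_of_soloFeetLawQ {dK unit ϱ τ ρlo ρhi : ℝ} (h : SoloFeetLawQ dK unit ϱ τ ρlo ρhi) :
    StencilTupleLawQ dK unit ϱ τ ρlo ρhi := by
  intro ρ h₁ h₂ dt hreal hhole
  choose! s hs using hreal
  set S : Finset E3 := (stencil 0).image s with hSdef
  have hSne : S.Nonempty := Finset.Nonempty.image ⟨0, mem_stencil_self 0⟩ s
  have hcard : S.card ≤ 7 := Finset.card_image_le.trans (card_stencil_le 0)
  set d : (Fin 3 → ℤ) → ℝ := latDepth (↑S) (-(ρ • stdFrame 0)) stdFrame ρ with hddef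
  have hagree : ∀ z ∈ stencil 0, shiftField d (axisZ 0) z = dt z := fun z hz => latDepth_feet_eq hs hz
  have h0 : shiftField d (axisZ 0) 0 = dt 0 := hagree 0 (mem_stencil_self 0)
  have hv : ∀ u, shiftField d (axisZ 0) (holeVertex 0 u) = dt (holeVertex 0 u) := fun u => hagree _ (mem_stencil_vertex 0 u)
  have hfeet : IsFeetHole dK ρ d (axisZ 0) := by
    obtain ⟨hr, hc, h140, hK⟩ := (isTupleHole_congr dK h0 hv).2 hhole
    refine ⟨odd_sum_axisZ_zero, ?_, ?_, ?_, ?_⟩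
    · rwa [← sf_hDepthMin]
    · rwa [← sf_hMaxKink]
    · rwa [← sf_hDepthMin]
    · rwa [← sf_hDepthMin]
  have hmain := h ρ h₁ h₂ (-(ρ • stdFrame 0)) stdFrame stdFrame_orthonormal S hSne hcard (axisZ 0) hfeet
  rw [← sf_feetHoleCost, ← sf_chargeDepth, feetHoleCost_congr ϱ τ hv, chargeDepth_congr h0 hv] at hmain
  exact hmain

/-- ★★★ **THE CERTIFIED TRANSLATION (PROVED)**: (D¹) `SoloFeetLawQ` ⟺ (T¹) `StencilTupleLawQ`, for all constants. -/
theorem soloFeetLawQ_iff_stencilTupleLaw (dK unit ϱ τ ρlo ρhi : ℝ) :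
    SoloFeetLawQ dK unit ϱ τ ρlo ρhi ↔ StencilTupleLawQ dK unit ϱ τ ρlo ρhi :=
  ⟨stencilTupleLaw_of_soloFeetLawQ, soloFeetLawQ_of_stencilTupleLaw⟩

end TupleLaw

end Summit.AtomisticToContinuum.Crystallization.Theorems.ChargedEnergyGapChartDial

end
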